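import Literature.Geometry.Kaehler.HolomorphicLineBundleDolbeault
import HarnessLib

/-!
# Restriction of the twisted Čech complex to a shrunk refinement; naturality of the comparison

Layer `Literature/Geometry/Kaehler`, sequel of `HolomorphicLineBundleDolbeault` (the twisted Čech
complex `C⁰ → Z¹`, `Ȟ¹(𝔙, 𝒪(L))` of a holomorphic line cocycle `L` on a refinement `𝔙 = (V_a)` of
its trivialising cover, and the Čech–Dolbeault comparison `toH01 : Ȟ¹(𝔙, 𝒪(L)) → H^{0,1}(M, L)`,
an isomorphism for finite `∂̄`-acyclic refinements). For the Cartan–Serre finiteness theorem with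
coefficients in `L` (Grauert–Remmert (1977), Kap. VI §4: nested Leray covers `𝔙₀ ≪ 𝔙₁ ≪ 𝔙₂ ≪ 𝔙₃`
on ONE index set) one needs the restriction maps between the Čech complexes of two refinements
`𝔙' ≤ 𝔙` on the same index set with the same refinement map (`IsShrink`: `V'_a ⊆ V_a`,
`τ' = τ`), and the fact that they induce isomorphisms in cohomology when both covers are acyclic:

* `resC0`, `resZ1` (cut-off by the indicators of the smaller sets), `resZ1_δ0` (a cochain map),
  `resH1 : Ȟ¹(𝔙, 𝒪(L)) → Ȟ¹(𝔙', 𝒪(L))`, `resZ1_resZ1` / `resH1_resH1` (functoriality);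
* **naturality of the comparison** `toH01_resH1`: for a partition of unity `ρ` subordinate to
  `𝔙'` (hence to `𝔙`), `toH01_{𝔙'} ∘ resH1 = toH01_{𝔙}` — the primitives `h_a = Σ_b ρ_b c_ba` of
  `c` and of its restriction agree on `V'_a`, so the glued closed `L`-valued `(0,1)`-forms `∂̄ h`
  coincide (`cocycleForm_resZ1`);
* `resH1_injective` (always), `resH1_surjective` / `resH1_bijective` (for `𝔙` finite and
  `∂̄`-acyclic, `M` Hausdorff σ-compact): restriction is an isomorphism
  `Ȟ¹(𝔙, 𝒪(L)) ≃ Ȟ¹(𝔙', 𝒪(L))` (both sides compare to `H^{0,1}(M, L)`, the bigger one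
  isomorphically by Leray, Voisin I, Thm. 4.41; Grauert–Remmert (1977), Kap. VI Einleitung).

Everything is proved; the definitions are the three restriction maps and the predicate `IsShrink`.

## References

* C. Voisin, *Hodge Theory and Complex Algebraic Geometry I* (2002), §4.3.1, Thm. 4.41.
  [VoisinHodgeI2002]
* H. Grauert, R. Remmert, *Theorie der Steinschen Räume* (1977), Kap. VI, Einleitung and §4.
  [GrauertRemmert1977]
* P. Griffiths, J. Harris, *Principles of Algebraic Geometry* (1978), pp. 34–35, 45–46.
  [GriffithsHarris1978]
-/

noncomputable section

open scoped Manifold ContDiff Topology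
open Set Filter Function
open Literature.NumberTheory.Transcendental

namespace Literature.Geometry.Kaehler

namespace HolomorphicLineBundle

variable {ι : Type*} {E : Type*} [NormedAddCommGroup E] [NormedSpace ℂ E]
  {M : Type*} [TopologicalSpace M] [ChartedSpace E M]

namespace Refinement

variable {L : HolomorphicLineBundle ι E M} {A : Type*} {R R' R'' : L.Refinement A}

/-! ### Shrinkings of a refinement -/

/-- **`𝔙'` is a shrinking of `𝔙`**: the same index set and refinement map, smaller sets
`V'_a ⊆ V_a` (Grauert–Remmert's `𝔙' < 𝔙` on one index set). [cite: GrauertRemmert1977, Kap. VI §4.1] -/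
structure IsShrink (R' R : L.Refinement A) : Prop where
  /-- the sets shrink -/
  subset : ∀ a, R'.V a ⊆ R.V a
  /-- the refinement maps agree -/
  τ_eq : ∀ a, R'.τ a = R.τ a

namespace IsShrink

variable (R) in
/-- A refinement is a shrinking of itself. [folklore] -/
protected theorem refl : R.IsShrink R :=
  ⟨fun _ ↦ Subset.rfl, fun _ ↦ rfl⟩

/-- Shrinkings compose. [folklore] -/
protected theorem trans (h' : R''.IsShrink R') (h : R'.IsShrink R) : R''.IsShrink R :=
  ⟨fun a ↦ (h'.subset a).trans (h.subset a), fun a ↦ (h'.τ_eq a).trans (h.τ_eq a)⟩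

/-- The presenting cocycles agree. [folklore] -/
theorem t_eq (h : R'.IsShrink R) (a b : A) : R'.t a b = R.t a b := by
  change L.coordChange (R'.τ a) (R'.τ b) = L.coordChange (R.τ a) (R.τ b)
  rw [h.τ_eq, h.τ_eq]

/-- The overlaps shrink. [folklore] -/
theorem inter_subset (h : R'.IsShrink R) (a b : A) : R'.V a ∩ R'.V b ⊆ R.V a ∩ R.V b :=
  inter_subset_inter (h.subset a) (h.subset b)

end IsShrink

/-! ### Restriction of cochains, cocycles and classes -/

section Res

/-- The raw restriction of a function cochain: cut off by the indicators of the smaller sets. [folklore] -/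
def resC0Fun (R' : L.Refinement A) (b : A → M → ℂ) : A → M → ℂ := fun a ↦ (R'.V a).indicator (b a)

/-- The raw restriction of a `1`-cochain: cut off by the indicators of the smaller overlaps. [folklore] -/
def resZ1Fun (R' : L.Refinement A) (c : A → A → M → ℂ) : A → A → M → ℂ := fun a b ↦
  (R'.V a ∩ R'.V b).indicator (c a b)

/-- The raw restriction on the smaller set. [folklore] -/
theorem resC0Fun_apply_of_mem (b : A → M → ℂ) {a : A} {x : M} (hx : x ∈ R'.V a) :
    resC0Fun R' b a x = b a x :=
  indicator_of_mem hx _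

/-- The raw restriction off the smaller set. [folklore] -/
theorem resC0Fun_apply_of_notMem (b : A → M → ℂ) {a : A} {x : M} (hx : x ∉ R'.V a) :
    resC0Fun R' b a x = 0 :=
  indicator_of_notMem hx _

/-- The raw restriction on the smaller overlap. [folklore] -/
theorem resZ1Fun_apply_of_mem (c : A → A → M → ℂ) {a b : A} {x : M} (hx : x ∈ R'.V a ∩ R'.V b) :
    resZ1Fun R' c a b x = c a b x :=
  indicator_of_mem hx _

/-- The raw restriction off the smaller overlap. [folklore] -/
theorem resZ1Fun_apply_of_notMem (c : A → A → M → ℂ) {a b : A} {x : M} (hx : x ∉ R'.V a ∩ R'.V b) :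
    resZ1Fun R' c a b x = 0 :=
  indicator_of_notMem hx _

/-- The raw restriction of cochains is additive. [folklore] -/
theorem resC0Fun_add (b b' : A → M → ℂ) : resC0Fun R' (b + b') = resC0Fun R' b + resC0Fun R' b' := by
  funext a x
  by_cases hx : x ∈ R'.V a
  · simp only [Pi.add_apply, resC0Fun_apply_of_mem _ hx]
  · simp only [Pi.add_apply, resC0Fun_apply_of_notMem _ hx, add_zero]

/-- The raw restriction of cochains is homogeneous. [folklore] -/
theorem resC0Fun_smul (r : ℂ) (b : A → M → ℂ) : resC0Fun R' (r • b) = r • resC0Fun R' b := by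
  funext a x
  by_cases hx : x ∈ R'.V a
  · simp only [Pi.smul_apply, resC0Fun_apply_of_mem _ hx]
  · simp only [Pi.smul_apply, resC0Fun_apply_of_notMem _ hx, smul_zero]

/-- The raw restriction of `1`-cochains is additive. [folklore] -/
theorem resZ1Fun_add (c c' : A → A → M → ℂ) : resZ1Fun R' (c + c') = resZ1Fun R' c + resZ1Fun R' c' := by
  funext a b x
  by_cases hx : x ∈ R'.V a ∩ R'.V b
  · simp only [Pi.add_apply, resZ1Fun_apply_of_mem _ hx]
  · simp only [Pi.add_apply, resZ1Fun_apply_of_notMem _ hx, add_zero]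

/-- The raw restriction of `1`-cochains is homogeneous. [folklore] -/
theorem resZ1Fun_smul (r : ℂ) (c : A → A → M → ℂ) : resZ1Fun R' (r • c) = r • resZ1Fun R' c := by
  funext a b x
  by_cases hx : x ∈ R'.V a ∩ R'.V b
  · simp only [Pi.smul_apply, resZ1Fun_apply_of_mem _ hx]
  · simp only [Pi.smul_apply, resZ1Fun_apply_of_notMem _ hx, smul_zero]

/-- The restriction of a holomorphic cochain is a holomorphic cochain of the shrinking. [folklore] -/
theorem resC0Fun_mem (h : R'.IsShrink R) (b : R.C0) : resC0Fun R' (b : A → M → ℂ) ∈ R'.C0 := fun a ↦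
  ⟨((C0.mdifferentiableOn b a).mono (h.subset a)).congr fun _ hx ↦ resC0Fun_apply_of_mem _ hx,
    fun _ hx ↦ resC0Fun_apply_of_notMem _ hx⟩

/-- The restriction of a twisted cocycle is a twisted cocycle of the shrinking (same `t_ab`). [folklore] -/
theorem resZ1Fun_mem (h : R'.IsShrink R) (c : R.Z1) : resZ1Fun R' (c : A → A → M → ℂ) ∈ R'.Z1 := by
  refine ⟨fun a b ↦ ((Z1.mdifferentiableOn c a b).mono (h.inter_subset a b)).congr fun _ hx ↦
      resZ1Fun_apply_of_mem _ hx, fun a b _ hx ↦ resZ1Fun_apply_of_notMem _ hx, fun a b d x hx ↦ ?_⟩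
  rw [resZ1Fun_apply_of_mem _ (show x ∈ R'.V a ∩ R'.V d from ⟨hx.1.1, hx.2⟩), resZ1Fun_apply_of_mem _ hx.1,
    resZ1Fun_apply_of_mem _ (show x ∈ R'.V b ∩ R'.V d from ⟨hx.1.2, hx.2⟩), h.t_eq]
  exact Z1.cocycle c (h.subset a hx.1.1) (h.subset b hx.1.2) (h.subset d hx.2)

/-- **Restriction of holomorphic `0`-cochains to a shrinking** `C⁰(𝔙, 𝒪(L)) → C⁰(𝔙', 𝒪(L))`.
[cite: GrauertRemmert1977, Kap. VI §4.1] -/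
def resC0 (h : R'.IsShrink R) : R.C0 →ₗ[ℂ] R'.C0 where
  toFun b := ⟨resC0Fun R' (b : A → M → ℂ), resC0Fun_mem h b⟩
  map_add' _ _ := Subtype.ext (resC0Fun_add _ _)
  map_smul' r _ := Subtype.ext (resC0Fun_smul r _)

/-- **Restriction of twisted cocycles to a shrinking** `Z¹(𝔙, 𝒪(L)) → Z¹(𝔙', 𝒪(L))`.
[cite: GrauertRemmert1977, Kap. VI §4.1] -/
def resZ1 (h : R'.IsShrink R) : R.Z1 →ₗ[ℂ] R'.Z1 where
  toFun c := ⟨resZ1Fun R' (c : A → A → M → ℂ), resZ1Fun_mem h c⟩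
  map_add' _ _ := Subtype.ext (resZ1Fun_add _ _)
  map_smul' r _ := Subtype.ext (resZ1Fun_smul r _)

/-- The restricted cochain on the smaller set. [folklore] -/
theorem resC0_apply_of_mem (h : R'.IsShrink R) (b : R.C0) {a : A} {x : M} (hx : x ∈ R'.V a) :
    (resC0 h b : A → M → ℂ) a x = (b : A → M → ℂ) a x :=
  resC0Fun_apply_of_mem _ hx

/-- The restricted cocycle on the smaller overlap. [folklore] -/
theorem resZ1_apply_of_mem (h : R'.IsShrink R) (c : R.Z1) {a b : A} {x : M} (hx : x ∈ R'.V a ∩ R'.V b) :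
    (resZ1 h c : A → A → M → ℂ) a b x = (c : A → A → M → ℂ) a b x :=
  resZ1Fun_apply_of_mem _ hx

/-- The underlying function of a restricted cocycle (definitional). [folklore] -/
theorem coe_resZ1 (h : R'.IsShrink R) (c : R.Z1) :
    (resZ1 h c : A → A → M → ℂ) = resZ1Fun R' (c : A → A → M → ℂ) :=
  rfl

/-- **Restriction is a cochain map**: `res (δ b) = δ (res b)`. [cite: GrauertRemmert1977, Kap. VI §4.1] -/
theorem resZ1_δ0 (h : R'.IsShrink R) (b : R.C0) : resZ1 h (R.δ0 b) = R'.δ0 (resC0 h b) := by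
  refine Z1.ext fun a d x hx ↦ ?_
  rw [resZ1_apply_of_mem h _ hx, δ0_apply_of_mem _ hx, δ0_apply_of_mem _ (h.inter_subset a d hx),
    resC0_apply_of_mem h b hx.1, resC0_apply_of_mem h b hx.2, h.t_eq]

/-- Restriction of cocycles is functorial. [folklore] -/
theorem resZ1_resZ1 (h' : R''.IsShrink R') (h : R'.IsShrink R) (c : R.Z1) :
    resZ1 h' (resZ1 h c) = resZ1 (h'.trans h) c := by
  refine Z1.ext fun a b x hx ↦ ?_
  rw [resZ1_apply_of_mem h' _ hx, resZ1_apply_of_mem h _ (h'.inter_subset a b hx),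
    resZ1_apply_of_mem (h'.trans h) _ hx]

/-- Restriction to itself is the identity. [folklore] -/
theorem resZ1_refl (c : R.Z1) : resZ1 (IsShrink.refl R) c = c :=
  Z1.ext fun _ _ _ hx ↦ resZ1_apply_of_mem _ _ hx

/-- **Restriction in twisted Čech cohomology** `Ȟ¹(𝔙, 𝒪(L)) → Ȟ¹(𝔙', 𝒪(L))` (coboundaries go to
coboundaries, `resZ1_δ0`). [cite: GrauertRemmert1977, Kap. VI §4.1] -/
def resH1 (h : R'.IsShrink R) : R.H1 →ₗ[ℂ] R'.H1 :=
  R.B1.liftQ ((H1.mk R').comp (resZ1 h)) fun c hc ↦ by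
    obtain ⟨b, rfl⟩ := LinearMap.mem_range.1 hc
    rw [LinearMap.mem_ker, LinearMap.comp_apply, resZ1_δ0]
    exact H1.mk_δ0 _

/-- Restriction on classes of cocycles. [folklore] -/
theorem resH1_mk (h : R'.IsShrink R) (c : R.Z1) : resH1 h (H1.mk R c) = H1.mk R' (resZ1 h c) :=
  rfl

/-- Restriction in cohomology is functorial. [folklore] -/
theorem resH1_resH1 (h' : R''.IsShrink R') (h : R'.IsShrink R) (ξ : R.H1) :
    resH1 h' (resH1 h ξ) = resH1 (h'.trans h) ξ := by
  obtain ⟨c, rfl⟩ := H1.mk_surjective ξ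
  rw [resH1_mk, resH1_mk, resH1_mk, resZ1_resZ1]

/-- Every class has a representing cocycle; restriction of a surjection. [folklore] -/
theorem resH1_surjective_of (h : R'.IsShrink R) (hs : ∀ c' : R'.Z1, ∃ (c : R.Z1) (b' : R'.C0),
    resZ1 h c = c' + R'.δ0 b') : Surjective (resH1 h) := by
  intro ξ'
  obtain ⟨c', rfl⟩ := H1.mk_surjective ξ'
  obtain ⟨c, b', hc⟩ := hs c'
  exact ⟨H1.mk R c, by rw [resH1_mk, hc, map_add, H1.mk_δ0, add_zero]⟩

end Res

/-! ### Naturality of the Čech–Dolbeault comparison under restriction -/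

section Natural

variable [Fintype A] (ρ : SmoothPartitionOfUnity A 𝓘(ℝ, E) M univ) {h : R'.IsShrink R}
  (hρ' : ρ.IsSubordinate R'.V)

omit [Fintype A] in
/-- A partition of unity subordinate to the shrinking is subordinate to the refinement. [folklore] -/
theorem _root_.Literature.Geometry.Kaehler.HolomorphicLineBundle.Refinement.IsShrink.isSubordinate
    (h : R'.IsShrink R) {ρ : SmoothPartitionOfUnity A 𝓘(ℝ, E) M univ} (hρ' : ρ.IsSubordinate R'.V) :
    ρ.IsSubordinate R.V := fun a ↦
  (hρ' a).trans (h.subset a)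

include hρ' in
/-- **The primitives of a cocycle and of its restriction agree on the smaller sets**:
`Σ_b ρ_b (res c)_ba = Σ_b ρ_b c_ba` on `V'_a` (where `ρ_b ≠ 0` the point lies in `V'_b`).
[cite: GriffithsHarris1978, p. 45] -/
theorem prim_resZ1 (h : R'.IsShrink R) (c : R.Z1) {a : A} {x : M} (hx : x ∈ R'.V a) :
    prim ρ (resZ1 h c) a x = prim ρ c a x := by
  refine Finset.sum_congr rfl fun b _ ↦ ?_
  by_cases hb : x ∈ R'.V b
  · rw [resZ1_apply_of_mem h c ⟨hb, hx⟩]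
  · rw [rho_apply_eq_zero ρ hρ' hb, Complex.ofReal_zero, zero_mul, zero_mul]

variable [FiniteDimensional ℂ E] [IsManifold 𝓘(ℂ, E) ω M] [IsManifold 𝓘(ℝ, E) ∞ M] [T2Space M]

omit [FiniteDimensional ℂ E] [IsManifold 𝓘(ℂ, E) ω M] [IsManifold 𝓘(ℝ, E) ∞ M] [T2Space M] in
include hρ' in
/-- `∂̄` of the primitives agree at the points of the smaller sets (the primitives agree on the open
`V'_a`). [folklore] -/
theorem dolbeaultBar_prim_resZ1 (h : R'.IsShrink R) (c : R.Z1) {a : A} {x : M} (hx : x ∈ R'.V a) :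
    dolbeaultBar (MForm.ofFun 𝓘(ℝ, E) (prim ρ (resZ1 h c) a)) x =
      dolbeaultBar (MForm.ofFun 𝓘(ℝ, E) (prim ρ c a)) x := by
  refine dolbeaultBar_congr_of_eventuallyEq ?_
  filter_upwards [(R'.isOpen a).mem_nhds hx] with z hz
  ext v
  rw [MForm.ofFun_apply, MForm.ofFun_apply, prim_resZ1 ρ hρ' h c hz]

/-- **The glued closed `L`-valued `(0,1)`-forms `∂̄ h` of a cocycle and of its restriction coincide**
(computed with the same partition of unity, subordinate to the shrinking). [cite: GriffithsHarris1978, p. 45] -/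
theorem cocycleForm_resZ1 (h : R'.IsShrink R) (c : R.Z1) :
    cocycleForm (R := R') ρ hρ' (resZ1 h c) = cocycleForm (R := R) ρ (h.isSubordinate hρ') c := by
  apply Subtype.ext
  rw [coe_cocycleForm, coe_cocycleForm]
  refine funext fun i ↦ funext fun x ↦ ?_
  rw [coe_glue_apply, coe_glue_apply]
  by_cases hi : x ∈ L.baseSet i
  · have ha' := R'.mem_idx x
    rw [glueFun_apply_of_mem _ ha' hi, glueFun_apply_of_mem _ (h.subset _ ha') hi, h.τ_eq,
      coe_cocycleFamily_apply, coe_cocycleFamily_apply, localDbar_apply_of_mem _ _ ha',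
      localDbar_apply_of_mem _ _ (h.subset _ ha'), coe_primForm, coe_primForm,
      dolbeaultBar_prim_resZ1 ρ hρ' h c ha']
  · rw [glueFun_apply_of_notMem _ hi, glueFun_apply_of_notMem _ hi]

/-- **Naturality of the Čech–Dolbeault comparison under restriction**:
`toH01_{𝔙'} (res ξ) = toH01_{𝔙} ξ` (same partition of unity, subordinate to the shrinking).
Grauert–Remmert (1977), Kap. VI Einleitung; Voisin I, Thm. 4.41 (functoriality of the Leray map).
[cite: VoisinHodgeI2002, Thm. 4.41] -/
theorem toH01_resH1 (h : R'.IsShrink R) (ξ : R.H1) :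
    toH01 (R := R') ρ hρ' (resH1 h ξ) = toH01 (R := R) ρ (h.isSubordinate hρ') ξ := by
  obtain ⟨c, rfl⟩ := H1.mk_surjective ξ
  rw [resH1_mk, toH01_mk, toH01_mk, cocycleForm_resZ1]

include hρ' in
/-- **Restriction between finite `∂̄`-acyclic refinements is injective in cohomology** (both compare
isomorphically to `H^{0,1}(M, L)`). [cite: GrauertRemmert1977, Kap. VI Einleitung] -/
theorem resH1_injective (h : R'.IsShrink R) : Injective (resH1 h) := fun ξ ξ' he ↦
  toH01_injective ρ (h.isSubordinate hρ') (by rw [← toH01_resH1 ρ hρ' h, ← toH01_resH1 ρ hρ' h, he])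

include hρ' in
/-- **Restriction between finite `∂̄`-acyclic refinements is surjective in cohomology** (Leray at the
bigger level, comparison injective at the smaller one). [cite: GrauertRemmert1977, Kap. VI Einleitung] -/
theorem resH1_surjective (h : R'.IsShrink R) (hac : ∀ a, IsDolbeaultAcyclic E M (R.isOpen a) 0) :
    Surjective (resH1 h) := fun ξ' ↦ by
  obtain ⟨ξ, hξ⟩ := toH01_surjective ρ (h.isSubordinate hρ') hac (toH01 (R := R') ρ hρ' ξ')
  exact ⟨ξ, toH01_injective ρ hρ' (by rw [toH01_resH1 ρ hρ' h, hξ]) ⟩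

omit [Fintype A] in
/-- **Restriction from a finite `∂̄`-acyclic refinement of a Hausdorff σ-compact manifold to a finite
shrinking is an isomorphism in twisted Čech cohomology** `Ȟ¹(𝔙, 𝒪(L)) ≃ Ȟ¹(𝔙', 𝒪(L))` (both sides
compare to `H^{0,1}(M, L)`; Grauert–Remmert (1977), Kap. VI Einleitung; Voisin I, Thm. 4.41).
[cite: GrauertRemmert1977, Kap. VI Einleitung] -/
theorem resH1_bijective [SigmaCompactSpace M] [Fintype A] (h : R'.IsShrink R)
    (hac : ∀ a, IsDolbeaultAcyclic E M (R.isOpen a) 0) : Bijective (resH1 h) := by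
  obtain ⟨ρ, hρ'⟩ := R'.exists_isSubordinate
  exact ⟨resH1_injective ρ hρ' h, resH1_surjective ρ hρ' h hac⟩

end Natural

end Refinement

end HolomorphicLineBundle

end Literature.Geometry.Kaehler

end
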